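import Mathlib
import Summits.Ventures.HodgeRepro.Tier4.Line4.HRWrapper
import Summits.Ventures.HodgeRepro.Tier4.Line4.LinRegularBridge
import Summits.Ventures.HodgeRepro.Tier4.Line4.DichotomyLin
import Summits.Ventures.HodgeRepro.Tier4.Line4.NaturalWitnessMu
import Summits.Ventures.HodgeRepro.Tier4.Line4.ProductWitness
import Summits.Ventures.HodgeRepro.Tier4.Line4.TransporterSeparation

/-!
# Tier4/Line4/TailSeesawSparse — (S-SPARSE) at the plane of record BY NAME, at the PLAIN levels `p^M`: the sparsity
scale `gth` with `gth (p^M) ≤ archDist γ` off the orbit of `γ₀` on the support of the natural level family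

Blind re-derivation cell `pub-hodge-repro`, Tier 4 «prove the step» (README §9–§10), seat t4-L2-p2 (gen 5; C-L4-7B-ASSEMBLY
S15841 — the (S-SPARSE) half of the residual `hdisp'` of TailSeesawArch, on L1-p3 g4's word S15939 «bind
`exists_sparsityScale_hR'` with the `∀ e` quantifier outside»).  Tree path
`lean/Summits/Ventures/HodgeRepro/Tier4/Line4/TailSeesawSparse.lean`.  Imports L1-p3's `Line4/HRWrapper`
(`exists_sparsityScale_hR'`: the scale along `p^(N+n₁)` on the transported row plane from the fibre bridge `hbridge`,
(S-SEP) `hsep` and the level supports `hfin`/`hfin₂`), L1-p3's `Line4/LinRegularBridge`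
(`orbitInv_ne_of_orbitOf_ne_of_isLinRegular`: the fibre bridge on the LIN locus), L1-p1's `Line4/DichotomyLin`
(`isLinRegular_of_not_transporter_row`: every non-transporter rational point is LIN-regular — (S-DICH)), L1-p1's
`Line4/NaturalWitnessMu` (`exists_levelK_mul_of_ffinMu_ne_zero`, the support of `ffinMu`) and `Line4/ProductWitness`
(`mem_levelK_of_levelInd_ne_zero`, `levelInd_ofFinPart`, the support of `testNat`'s finite factor), and L2-p3's
`Line4/TransporterSeparation` (`exists_level_separates_transporter`, (S-SEP) by name).  Mathlib-level; no literature; no `def`.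

**`exists_sparsityScale_plain`**: on `(mixedRow q (a 0) (a 2)).withTransportedTorus g g' hgg' hg'g hgΩ` (= `seesawPlane`),
under `ht`, `hn`, `_ha`, `lam`, `_hlam`, `_hiso`, `hgen`, `hlin` and a prime `p`, for EVERY archimedean coefficient `finf` and
test `e` (nothing is assumed of either — L1-p3 S15939: the scale depends on `g, γ₀, p` only; `finf`/`e` enter only through
the level supports of the FINITE factors `ffinMu`, `levelInd`): a sparsity scale `gth → ∞` with `gth (p ^ M) ≤ archDist γ`
for every rational `γ` off the orbit of `γ₀` at which `(finf ⊗ ffinMu (p^M)) ⋆ testNat e (p^M)` does not vanish on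
`D_T⁻¹ γ D_T′`, at EVERY level `M` — TailPieces' / TailSeesaw's `hR` binder verbatim.  The threshold `n₁` of (S-SEP) is
absorbed: below `p^{n₁}` the scale is `0 ≤ archDist` (`archDist_nonneg`), above it `gth (p^M) := gth₀ (M − n₁)` through
`Nat.log p` (`Nat.log_pow`).

Nothing here says anything about the status of the Hodge conjecture for CM abelian varieties, which is NOT proved
(HC_CM is NOT proved by anyone in this repository).
-/

set_option autoImplicit false

noncomputable section

namespace Summit.Ventures.HodgeRepro.Tier4.Line4

open Matrix MeasureTheory Topology Filter NumberField IsDedekindDomain Summit.Ventures.HodgeRepro.Tier4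
  Summit.Ventures.HodgeRepro.Tier4.Common Summit.Ventures.HodgeRepro.Tier4.Line1
  Summit.Ventures.HodgeRepro.Tier4.Line1.RTF Summit.Ventures.HodgeRepro.Tier4.Line4.L1Class

open scoped NumberField NNReal ENNReal Pointwise Matrix

section Scale

/-- A real sequence tending to infinity, read at `Nat.log p L − n₁` and cut off below `p^{n₁}`, tends to infinity. -/
theorem tendsto_scale_log {p n₁ : ℕ} (hp : 2 ≤ p) {gth₀ : ℕ → ℝ} (hg : Tendsto gth₀ atTop atTop) :
    Tendsto (fun L : ℕ => if L < p ^ n₁ then (0 : ℝ) else gth₀ (Nat.log p L - n₁)) atTop atTop := by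
  rw [tendsto_atTop_atTop]
  intro b
  obtain ⟨N, hN⟩ := tendsto_atTop_atTop.1 hg b
  refine ⟨p ^ (N + n₁), fun L hL => ?_⟩
  have hp1 : 1 < p := hp
  have hlt : ¬ L < p ^ n₁ := by
    rw [not_lt]
    exact le_trans (Nat.pow_le_pow_right (by omega) (Nat.le_add_left n₁ N)) hL
  rw [if_neg hlt]
  refine hN _ ?_
  have hlog : N + n₁ ≤ Nat.log p L := Nat.le_log_of_pow_le hp1 hL
  omega

end Scale

section Sparse

variable {k : Type} [Field k] [NumberField k]

/-- **(S-SPARSE) at the plane of record, at every plain level, for every `(finf, e)`** — TailSeesaw's `hR` by name. -/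
theorem exists_sparsityScale_plain (q : QuadData k) (ht : q.t = 0) (hn : ¬ IsSquare (-q.n))
    (a : Fin 4 → k) (ha : ∀ i, a i ≠ 0)
    (g g' : Matrix (Fin 4) (Fin 4) k) (hgg' : g * g' = 1) (hg'g : g' * g = 1)
    (hgΩ : g * (PlaneData.mixedRow q (a 0) (a 2)).Ω = (PlaneData.mixedRow q (a 0) (a 2)).Ω * g)
    (lam : k) (hlam : lam ≠ 0)
    (hiso : g * (PlaneData.mixedRow q (a 1) (a 3)).B * gᵀ = lam • (PlaneData.mixedRow q (a 0) (a 2)).B)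
    [MeasurableSpace (GA ((PlaneData.mixedRow q (a 0) (a 2)).withTransportedTorus g g' hgg' hg'g hgΩ))]
    [BorelSpace (GA ((PlaneData.mixedRow q (a 0) (a 2)).withTransportedTorus g g' hgg' hg'g hgΩ))]
    (R : RTFData ((PlaneData.mixedRow q (a 0) (a 2)).withTransportedTorus g g' hgg' hg'g hgΩ))
    (μ : Measure (GA ((PlaneData.mixedRow q (a 0) (a 2)).withTransportedTorus g g' hgg' hg'g hgΩ))) [μ.IsHaarMeasure]
    [R.μT.IsHaarMeasure] [R.μT'.IsHaarMeasure]
    (DG : Set (GA ((PlaneData.mixedRow q (a 0) (a 2)).withTransportedTorus g g' hgg' hg'g hgΩ)))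
    (fdG : IsFundamentalDomain (rationalPoints ((PlaneData.mixedRow q (a 0) (a 2)).withTransportedTorus g g' hgg' hg'g hgΩ)) DG μ)
    (compG : IsCompact (closure DG)) (compT : IsCompact (closure R.DT)) (compT' : IsCompact (closure R.DT'))
    (hgen : IsGenuineRow ((PlaneData.mixedRow q (a 0) (a 2)).withTransportedTorus g g' hgg' hg'g hgΩ))
    (γ₀ : rationalPoints ((PlaneData.mixedRow q (a 0) (a 2)).withTransportedTorus g g' hgg' hg'g hgΩ))
    (hlin : IsLinRegular ((PlaneData.mixedRow q (a 0) (a 2)).withTransportedTorus g g' hgg' hg'g hgΩ) γ₀)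
    (p : ℕ) (hp : p.Prime)
    (μ₀ : Measure (finitePart ((PlaneData.mixedRow q (a 0) (a 2)).withTransportedTorus g g' hgg' hg'g hgΩ)))
    (finf e : GA ((PlaneData.mixedRow q (a 0) (a 2)).withTransportedTorus g g' hgg' hg'g hgΩ) → ℂ) :
    ∃ gth : ℕ → ℝ, Tendsto gth atTop atTop ∧
      ∀ (M : ℕ) (γ : (Setting.ofAdelicData _ R μ DG fdG compG compT compT').Gk),
        (Setting.ofAdelicData _ R μ DG fdG compG compT compT').orbitOf γ ∉
          ({(Setting.ofAdelicData _ R μ DG fdG compG compT compT').orbitOf γ₀} :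
            Finset (Setting.ofAdelicData _ R μ DG fdG compG compT compT').Orbit) →
        (∃ t ∈ R.DT, ∃ t' ∈ R.DT',
          (Setting.ofAdelicData _ R μ DG fdG compG compT compT').conv
            (prodFn _ finf (ffinMu _ μ₀ (γ₀ : GA ((PlaneData.mixedRow q (a 0) (a 2)).withTransportedTorus g g' hgg' hg'g hgΩ)) (p ^ M)))
            (testNat _ e (p ^ M))
            ((t : GA ((PlaneData.mixedRow q (a 0) (a 2)).withTransportedTorus g g' hgg' hg'g hgΩ))⁻¹ * γ *
              (t' : GA ((PlaneData.mixedRow q (a 0) (a 2)).withTransportedTorus g g' hgg' hg'g hgΩ))) ≠ 0) →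
        gth (p ^ M) ≤ archDist _ (γ : GA ((PlaneData.mixedRow q (a 0) (a 2)).withTransportedTorus g g' hgg' hg'g hgΩ)) := by
  -- the normalisation
  have hn0 : q.n ≠ 0 := by
    intro h0
    apply hn
    rw [h0, neg_zero]
    exact ⟨0, by ring⟩
  -- (S-SEP) by name: the threshold `n₁`
  obtain ⟨n₁, hsep⟩ := exists_level_separates_transporter _ hgen γ₀ hlin p hp
  -- the fibre bridge on the non-transporters (DICH-LIN + the LIN bridge)
  have hW : ((PlaneData.mixedRow q (a 0) (a 2)).withTransportedTorus g g' hgg' hg'g hgΩ) = (PlaneData.ofLinesRow q (a 0) (a 2) (-1)).withTransportedTorus g g' hgg' hg'g hgΩ := rfl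
  have hbridge : ∀ γ : (Setting.ofAdelicData ((PlaneData.mixedRow q (a 0) (a 2)).withTransportedTorus g g' hgg' hg'g hgΩ) R μ DG fdG compG compT compT').Gk,
      ¬ ((torusT ((PlaneData.mixedRow q (a 0) (a 2)).withTransportedTorus g g' hgg' hg'g hgΩ)).map (MulAut.conj ((γ : GA ((PlaneData.mixedRow q (a 0) (a 2)).withTransportedTorus g g' hgg' hg'g hgΩ)))⁻¹).toMonoidHom = torusT' ((PlaneData.mixedRow q (a 0) (a 2)).withTransportedTorus g g' hgg' hg'g hgΩ)) →
      (Setting.ofAdelicData ((PlaneData.mixedRow q (a 0) (a 2)).withTransportedTorus g g' hgg' hg'g hgΩ) R μ DG fdG compG compT compT').orbitOf γ ≠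
        (Setting.ofAdelicData ((PlaneData.mixedRow q (a 0) (a 2)).withTransportedTorus g g' hgg' hg'g hgΩ) R μ DG fdG compG compT compT').orbitOf γ₀ →
      orbitInv ((PlaneData.mixedRow q (a 0) (a 2)).withTransportedTorus g g' hgg' hg'g hgΩ) g (γ : GA ((PlaneData.mixedRow q (a 0) (a 2)).withTransportedTorus g g' hgg' hg'g hgΩ)) ≠ orbitInv ((PlaneData.mixedRow q (a 0) (a 2)).withTransportedTorus g g' hgg' hg'g hgΩ) g (γ₀ : GA ((PlaneData.mixedRow q (a 0) (a 2)).withTransportedTorus g g' hgg' hg'g hgΩ)) := fun γ hnt hne =>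
    orbitInv_ne_of_orbitOf_ne_of_isLinRegular q (a 0) (a 2) (-1) (a 1) (a 3) (-1) g g' hgg' hg'g hgΩ ((PlaneData.mixedRow q (a 0) (a 2)).withTransportedTorus g g' hgg' hg'g hgΩ) hW R μ DG fdG
      compG compT compT' ht hn0 hn (ha 0) (ha 2) (by norm_num) (ha 1) (ha 3) (by norm_num) lam hlam hiso
      (isLinRegular_of_not_transporter_row ((PlaneData.mixedRow q (a 0) (a 2)).withTransportedTorus g g' hgg' hg'g hgΩ) hgen γ hnt) hlin hne
  -- the level supports of the natural family
  have hfin : ∀ (N : ℕ) (x : GA ((PlaneData.mixedRow q (a 0) (a 2)).withTransportedTorus g g' hgg' hg'g hgΩ)), ffinMu ((PlaneData.mixedRow q (a 0) (a 2)).withTransportedTorus g g' hgg' hg'g hgΩ) μ₀ (γ₀ : GA ((PlaneData.mixedRow q (a 0) (a 2)).withTransportedTorus g g' hgg' hg'g hgΩ)) (p ^ (N + n₁)) x ≠ 0 →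
      ∃ κ₁ ∈ levelK ((PlaneData.mixedRow q (a 0) (a 2)).withTransportedTorus g g' hgg' hg'g hgΩ) (p ^ (N + n₁)), ∃ κ₂ ∈ levelK ((PlaneData.mixedRow q (a 0) (a 2)).withTransportedTorus g g' hgg' hg'g hgΩ) (p ^ (N + n₁)),
        GA.ofFinPart ((PlaneData.mixedRow q (a 0) (a 2)).withTransportedTorus g g' hgg' hg'g hgΩ) x = κ₁ * GA.ofFinPart ((PlaneData.mixedRow q (a 0) (a 2)).withTransportedTorus g g' hgg' hg'g hgΩ) (γ₀ : GA ((PlaneData.mixedRow q (a 0) (a 2)).withTransportedTorus g g' hgg' hg'g hgΩ)) * κ₂ := fun N x h =>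
    exists_levelK_mul_of_ffinMu_ne_zero ((PlaneData.mixedRow q (a 0) (a 2)).withTransportedTorus g g' hgg' hg'g hgΩ) μ₀ (γ₀ : GA ((PlaneData.mixedRow q (a 0) (a 2)).withTransportedTorus g g' hgg' hg'g hgΩ)) h
  have hfin₂ : ∀ (N : ℕ) (x : GA ((PlaneData.mixedRow q (a 0) (a 2)).withTransportedTorus g g' hgg' hg'g hgΩ)), testNat ((PlaneData.mixedRow q (a 0) (a 2)).withTransportedTorus g g' hgg' hg'g hgΩ) e (p ^ (N + n₁)) x ≠ 0 →
      GA.ofFinPart ((PlaneData.mixedRow q (a 0) (a 2)).withTransportedTorus g g' hgg' hg'g hgΩ) x ∈ levelK ((PlaneData.mixedRow q (a 0) (a 2)).withTransportedTorus g g' hgg' hg'g hgΩ) (p ^ (N + n₁)) := by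
    intro N x h
    rw [testNat_of_ne_zero ((PlaneData.mixedRow q (a 0) (a 2)).withTransportedTorus g g' hgg' hg'g hgΩ) e (pow_ne_zero _ hp.ne_zero)] at h
    have h' : e (GA.ofInfPart ((PlaneData.mixedRow q (a 0) (a 2)).withTransportedTorus g g' hgg' hg'g hgΩ) x) * levelInd ((PlaneData.mixedRow q (a 0) (a 2)).withTransportedTorus g g' hgg' hg'g hgΩ) (p ^ (N + n₁)) (GA.ofFinPart ((PlaneData.mixedRow q (a 0) (a 2)).withTransportedTorus g g' hgg' hg'g hgΩ) x) ≠ 0 := h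
    have h2 : levelInd ((PlaneData.mixedRow q (a 0) (a 2)).withTransportedTorus g g' hgg' hg'g hgΩ) (p ^ (N + n₁)) (GA.ofFinPart ((PlaneData.mixedRow q (a 0) (a 2)).withTransportedTorus g g' hgg' hg'g hgΩ) x) ≠ 0 := right_ne_zero_of_mul h'
    rw [levelInd_ofFinPart] at h2
    exact mem_levelK_of_levelInd_ne_zero ((PlaneData.mixedRow q (a 0) (a 2)).withTransportedTorus g g' hgg' hg'g hgΩ) h2
  obtain ⟨gth₀, hg₀, hR₀⟩ := exists_sparsityScale_hR' q (a 0) (a 2) (-1) (a 1) (a 3) (-1) g g' hgg' hg'g hgΩ ((PlaneData.mixedRow q (a 0) (a 2)).withTransportedTorus g g' hgg' hg'g hgΩ) hW R μ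
    DG fdG compG compT compT' (ha 0) (ha 2) (by norm_num) (ha 1) (ha 3) (by norm_num) lam hiso γ₀ hbridge finf
    (fun N => ffinMu ((PlaneData.mixedRow q (a 0) (a 2)).withTransportedTorus g g' hgg' hg'g hgΩ) μ₀ (γ₀ : GA ((PlaneData.mixedRow q (a 0) (a 2)).withTransportedTorus g g' hgg' hg'g hgΩ)) N) (fun N => testNat ((PlaneData.mixedRow q (a 0) (a 2)).withTransportedTorus g g' hgg' hg'g hgΩ) e N) p n₁ hp.two_le hsep hfin hfin₂
  refine ⟨fun L => if L < p ^ n₁ then (0 : ℝ) else gth₀ (Nat.log p L - n₁), tendsto_scale_log hp.two_le hg₀, ?_⟩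
  intro M γ hoff hsupp
  by_cases hM : p ^ M < p ^ n₁
  · simp only [if_pos hM]
    exact archDist_nonneg _ _
  · simp only [if_neg hM]
    rw [Nat.log_pow hp.one_lt]
    have hMn : n₁ ≤ M := (pow_le_pow_iff_right₀ hp.one_lt).1 (not_lt.1 hM)
    have hM' : M = (M - n₁) + n₁ := (Nat.sub_add_cancel hMn).symm
    have hsupp' : ∃ t ∈ R.DT, ∃ t' ∈ R.DT',
        (Setting.ofAdelicData ((PlaneData.mixedRow q (a 0) (a 2)).withTransportedTorus g g' hgg' hg'g hgΩ) R μ DG fdG compG compT compT').conv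
          (prodFn ((PlaneData.mixedRow q (a 0) (a 2)).withTransportedTorus g g' hgg' hg'g hgΩ) finf ((fun N => ffinMu ((PlaneData.mixedRow q (a 0) (a 2)).withTransportedTorus g g' hgg' hg'g hgΩ) μ₀ (γ₀ : GA ((PlaneData.mixedRow q (a 0) (a 2)).withTransportedTorus g g' hgg' hg'g hgΩ)) N) (p ^ ((M - n₁) + n₁))))
          ((fun N => testNat ((PlaneData.mixedRow q (a 0) (a 2)).withTransportedTorus g g' hgg' hg'g hgΩ) e N) (p ^ ((M - n₁) + n₁)))
          ((t : GA ((PlaneData.mixedRow q (a 0) (a 2)).withTransportedTorus g g' hgg' hg'g hgΩ))⁻¹ * γ * (t' : GA ((PlaneData.mixedRow q (a 0) (a 2)).withTransportedTorus g g' hgg' hg'g hgΩ))) ≠ 0 := by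
      rw [← hM']
      exact hsupp
    exact hR₀ (M - n₁) γ hoff hsupp'

end Sparse

end Summit.Ventures.HodgeRepro.Tier4.Line4

end
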